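import Summits.Ventures.LatticeQCDFlow.Scaling.SimulatedTemperingFiniteGap
import Summits.Ventures.LatticeQCDFlow.Scaling.ReplicaExchangeFiniteSampler
import Literature.Probability.MarkovChains.DirichletFormComparison

/-!
HONEST FRAMING: exact (Metropolis-corrected) sampling algorithms for lattice gauge theory; figures
of merit are autocorrelation/cost numbers at stated couplings and volumes; no continuum-physics
claim.

# SimulatedTemperingWeightRobustness — IMPERFECT LEVEL WEIGHTS COST A CONSTANT FACTOR, NOT A CHANGE OF SCALING:
# `(lo/hi)·Gap(exact weights) ≤ Gap(weights w) ≤ (hi/lo)·Gap(exact weights)` WHENEVER `lo ≤ (K+1)w_k ≤ hi`;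
# REPLICA EXCHANGE IS INVARIANT UNDER REWEIGHTING AND NEEDS NO WEIGHTS AT ALL
# (lean-2 GEN-17, ours)

Venture-side (OURS).  Cell `lqcd-flow` (pub-lqcd), unit `pub-lqcd-lean-2-g17`, 2026-08-25.  Chapter X–Z work with
the simulated-tempering sampler `stFinSampler t μ M` of `Scaling/SimulatedTemperingFiniteSampler` for EXACTLY weighted
levels (`Σ_x μ_k(x) = 1` for every `k`, so that the target `π(k,x) = μ_k(x)/(K+1)` puts mass `1/(K+1)` on every
level).  In practice the normalising constants `Z(β_k)` are only ESTIMATED, and the sampler that is actually run is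
the same Metropolis construction for the family `μʷ_k = (K+1)·w_k·μ_k` with level weights `w_k > 0`, `Σ_k w_k = 1`
(`w_k ∝ ĉ_k Z_k` for the estimates `ĉ_k ≈ 1/Z_k`): literally `stFinSampler t μʷ M` — no new definition.  This file
quantifies what the error costs, by the Literature's simple comparison of reversible chains (Levin–Peres–Wilmer
Lemma 13.18, PROVED in `Literature/Probability/MarkovChains/DirichletFormComparison`).

## What is proved

* §1 `dirichletForm_ge_of_flow_ge` — generic: if `a·π(x)P(x,y) ≤ π'(x)P'(x,y)` off the diagonal then
  `a·𝓔_π(P;f) ≤ 𝓔_{π'}(P';f)` for every `f`.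
* §2 pointwise comparable families `a·μ_k(x) ≤ μ'_k(x) ≤ b·μ_k(x)`: `stFinLaw_le_of_le`, **`stFin_flow_ge_of_le`**
  (every off-diagonal stationary flow of `stFinSampler t μ' M` is at least `a` times that of `stFinSampler t μ M`:
  the Metropolis level flows are `min{μ'_k(x), μ'_l(x)}·t/(2(K+1))`, the within-level flows `μ'_k(x)(1−t)M_k(x,y)/(K+1)`),
  `stFin_dirichletForm_ge_of_le`, and **`stFin_spectralGap_ge_of_comparable`**:
  `(a/b)·Gap(stFinSampler t μ M) ≤ Gap(stFinSampler t μ' M)` (both targets probability laws, `M_k` reversible for both).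
* §4 contrast — **`ptFinSampler_smul`**: the replica-exchange sampler of `Scaling/ReplicaExchangeFiniteSampler` is
  INVARIANT under `μ_k ↦ c_kμ_k` (`c_k ≠ 0`): swaps need no normalising constants (`ptFinLaw_smul`: the target only
  rescales by `Π_k c_k`; the Literature's `mhKernel_smul`).
* §3 level weights `w`: `detailedBalance_smul`, `sum_stFinLaw_weights` (the target of `μʷ` is a probability law iff
  `Σ w = 1`), **`stFin_blockMass_weights`** (the sampler spends the fraction `w_k` of its time at level `k`),
  **`stFinWeights_spectralGap_ge`** / **`stFinWeights_spectralGap_le`**: `lo ≤ (K+1)w_k ≤ hi` for all `k` ⇒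
  `(lo/hi)·Gap(μ) ≤ Gap(μʷ) ≤ (hi/lo)·Gap(μ)`, and **`stFinWeights_tauInt_le`**: a Poincaré constant `γ` of the
  exactly weighted sampler gives `τ_int(g) ≤ hi/(lo·γ) − ½` for EVERY non-constant observable of the misweighted one
  (`0 < t < 1`, irreducible `M_k`).

Reading (no numerics implied): free energies `log Z(β_k)` known to `±η` give `(K+1)w_k ∈ [e^{−2η}, e^{2η}]`, hence
every spectral-gap guarantee or obstruction of chapters X–Z transfers to the sampler actually run with a factor at
most `e^{4η}` — the SCALING in `K`, persistence, overlaps and within-mode gaps is untouched; what imperfect weights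
change is the level occupation (`w_k` instead of `1/(K+1)`).  NOT CLAIMED: how the weights are estimated (Wang–Landau,
iterated runs) or the cost of doing so; anything measured.  Literature grade (cell rule): KNOWN MECHANISM (comparison
of Dirichlet forms), NEW TYPING for the tempering sampler; Lemma 13.18 imported PROVED; no new bib keys.
-/

noncomputable section

open Finset
open Literature.Probability.MarkovChains
open Literature.Probability.MarkovChains.Decomposition

namespace Summit.Ventures.LatticeQCDFlow.Scaling

/-! ## §1 Dirichlet forms compare when the off-diagonal flows do -/

section Generic

variable {X : Type*} [Fintype X] [DecidableEq X]

/-- **If `a·π(x)P(x,y) ≤ π'(x)P'(x,y)` for all `x ≠ y` then `a·𝓔_π(P;f) ≤ 𝓔_{π'}(P';f)`** (the diagonal terms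
of a Dirichlet form vanish). [ours] -/
theorem dirichletForm_ge_of_flow_ge {π π' : X → ℝ} {P P' : Matrix X X ℝ} {a : ℝ}
    (h : ∀ x y, x ≠ y → a * (π x * P x y) ≤ π' x * P' x y) (f : X → ℝ) :
    a * dirichletForm π P f ≤ dirichletForm π' P' f := by
  unfold dirichletForm
  rw [mul_left_comm, mul_sum]
  refine mul_le_mul_of_nonneg_left (sum_le_sum fun x _ => ?_) (by norm_num)
  rw [mul_sum]
  refine sum_le_sum fun y _ => ?_
  by_cases hxy : x = y
  · subst hxy
    simp
  · calc a * (π x * P x y * (f x - f y) ^ 2) = a * (π x * P x y) * (f x - f y) ^ 2 := by ring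
      _ ≤ π' x * P' x y * (f x - f y) ^ 2 := mul_le_mul_of_nonneg_right (h x y hxy) (sq_nonneg _)

omit [Fintype X] [DecidableEq X] in
/-- Detailed balance survives rescaling the law by a constant. [ours] -/
theorem detailedBalance_smul {π : X → ℝ} {P : Matrix X X ℝ} (hDB : DetailedBalance π P) (c : ℝ) :
    DetailedBalance (fun x => c * π x) P := by
  intro x y
  have := hDB x y
  calc c * π x * P x y = c * (π x * P x y) := by ring
    _ = c * (π y * P y x) := by rw [this]
    _ = c * π y * P y x := by ring

end Generic

/-! ## §2 Pointwise comparable families of levels -/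

section Comparable

variable {S : Type*} [Fintype S] [DecidableEq S] {K : ℕ} {μ μ' : Fin (K + 1) → S → ℝ}
  {M : Fin (K + 1) → Matrix S S ℝ} {t a b : ℝ}

omit [Fintype S] [DecidableEq S] in
/-- `μ'_k ≤ b·μ_k` pointwise ⇒ `π' ≤ b·π` for the targets. [ours] -/
theorem stFinLaw_le_of_le (hb : ∀ k x, μ' k x ≤ b * μ k x) (p : Fin (K + 1) × S) :
    stFinLaw μ' p ≤ b * stFinLaw μ p := by
  unfold stFinLaw
  rw [← mul_div_assoc]
  exact div_le_div_of_nonneg_right (hb p.1 p.2) (by positivity)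

/-- **Every off-diagonal stationary flow of `stFinSampler t μ' M` is at least `a` times that of
`stFinSampler t μ M`** when `a·μ ≤ μ'` pointwise (`a ≥ 0`, `0 ≤ t ≤ 1`, `M_k ≥ 0`). [ours] -/
theorem stFin_flow_ge_of_le (hμ : ∀ k x, 0 < μ k x) (hμ' : ∀ k x, 0 < μ' k x) (ha0 : 0 ≤ a)
    (ha : ∀ k x, a * μ k x ≤ μ' k x) (hM : ∀ k, IsRowStochastic (M k)) (ht0 : 0 ≤ t) (ht1 : t ≤ 1)
    {p q : Fin (K + 1) × S} (hqp : q ≠ p) :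
    a * (stFinLaw μ p * stFinSampler t μ M p q) ≤ stFinLaw μ' p * stFinSampler t μ' M p q := by
  rw [stFinSampler_apply, stFinSampler_apply, mul_add, mul_add, mul_add, mul_left_comm (stFinLaw μ p) t,
    mul_left_comm (stFinLaw μ' p) t, stFinLaw_mul_stFinLevel hμ hqp, stFinLaw_mul_stFinLevel hμ' hqp,
    mul_left_comm (stFinLaw μ p) (1 - t), mul_left_comm (stFinLaw μ' p) (1 - t), stFinWithin_apply]
  refine add_le_add ?_ ?_
  · -- level moves: `a·min{μ_k, μ_l} ≤ min{μ'_k, μ'_l}`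
    split_ifs with h
    · rw [← mul_assoc, mul_comm a t, mul_assoc]
      refine mul_le_mul_of_nonneg_left ?_ ht0
      rw [← mul_div_assoc]
      refine div_le_div_of_nonneg_right ?_ (by positivity)
      rw [mul_min_of_nonneg _ _ ha0]
      exact min_le_min (ha p.1 p.2) (ha q.1 p.2)
    · simp
  · -- within-level moves: `a·μ_k(x)M_k(x,y) ≤ μ'_k(x)M_k(x,y)`
    split_ifs with h
    · have hW : 0 ≤ M p.1 p.2 q.2 := (hM p.1).1 p.2 q.2
      have h1t : 0 ≤ 1 - t := by linarith
      unfold stFinLaw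
      calc a * ((1 - t) * (μ p.1 p.2 / (K + 1) * M p.1 p.2 q.2))
          = (1 - t) * (a * μ p.1 p.2 / (K + 1) * M p.1 p.2 q.2) := by ring
        _ ≤ (1 - t) * (μ' p.1 p.2 / (K + 1) * M p.1 p.2 q.2) :=
          mul_le_mul_of_nonneg_left (mul_le_mul_of_nonneg_right
            (div_le_div_of_nonneg_right (ha p.1 p.2) (by positivity)) hW) h1t
    · simp

/-- Hence `a·𝓔_π(stFinSampler t μ M; f) ≤ 𝓔_{π'}(stFinSampler t μ' M; f)` for every `f`. [ours] -/
theorem stFin_dirichletForm_ge_of_le (hμ : ∀ k x, 0 < μ k x) (hμ' : ∀ k x, 0 < μ' k x) (ha0 : 0 ≤ a)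
    (ha : ∀ k x, a * μ k x ≤ μ' k x) (hM : ∀ k, IsRowStochastic (M k)) (ht0 : 0 ≤ t) (ht1 : t ≤ 1)
    (f : Fin (K + 1) × S → ℝ) :
    a * dirichletForm (stFinLaw μ) (stFinSampler t μ M) f
      ≤ dirichletForm (stFinLaw μ') (stFinSampler t μ' M) f :=
  dirichletForm_ge_of_flow_ge (fun _ _ hxy => stFin_flow_ge_of_le hμ hμ' ha0 ha hM ht0 ht1 (Ne.symm hxy)) f

/-- **COMPARABLE LEVELS GIVE COMPARABLE GAPS:** if `a·μ_k(x) ≤ μ'_k(x) ≤ b·μ_k(x)` for all `k, x` (`a > 0`),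
both targets are probability laws and every `M_k` is row-stochastic and reversible for both `μ_k` and `μ'_k`, then
`(a/b)·Gap(stFinSampler t μ M) ≤ Gap(stFinSampler t μ' M)` (`0 ≤ t ≤ 1`, `K ≥ 1`). [ours] -/
theorem stFin_spectralGap_ge_of_comparable [Nonempty S] (hK : 1 ≤ K) (hμ : ∀ k x, 0 < μ k x)
    (hμ' : ∀ k x, 0 < μ' k x) (hπ1 : ∑ p, stFinLaw μ p = 1) (hπ'1 : ∑ p, stFinLaw μ' p = 1) (ha0 : 0 < a)
    (ha : ∀ k x, a * μ k x ≤ μ' k x) (hb : ∀ k x, μ' k x ≤ b * μ k x) (hM : ∀ k, IsRowStochastic (M k))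
    (hMrev : ∀ k, DetailedBalance (μ k) (M k)) (hMrev' : ∀ k, DetailedBalance (μ' k) (M k))
    (ht0 : 0 ≤ t) (ht1 : t ≤ 1) :
    a / b * spectralGap (stFinLaw μ) (stFinSampler t μ M)
      ≤ spectralGap (stFinLaw μ') (stFinSampler t μ' M) := by
  haveI : Nontrivial (Fin (K + 1)) := Fin.nontrivial_iff_two_le.mpr (by omega)
  obtain ⟨x₀⟩ := ‹Nonempty S›
  have hb0 : 0 < b := by
    have h1 := (ha 0 x₀).trans (hb 0 x₀)
    have : 0 < a * μ 0 x₀ := mul_pos ha0 (hμ 0 x₀)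
    nlinarith [hμ 0 x₀]
  -- Lemma 13.18 with `(π, P) := ` the primed sampler and `(π̃, P̃) := ` the unprimed one, `α = 1/a`, `c = b`
  have hα : ∀ f : Fin (K + 1) × S → ℝ, dirichletForm (stFinLaw μ) (stFinSampler t μ M) f
      ≤ 1 / a * dirichletForm (stFinLaw μ') (stFinSampler t μ' M) f := by
    intro f
    have h := stFin_dirichletForm_ge_of_le hμ hμ' ha0.le ha hM ht0 ht1 f
    rw [one_div, le_inv_mul_iff₀ ha0]
    exact h
  have h := LevinPeres2017_lemma_13_18 (stFinLaw_pos hμ') hπ'1 (stFinLaw_pos hμ) hπ1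
    (stFinSampler_isRowStochastic hμ' hM ht0 ht1) (stFinSampler_detailedBalance hμ' hMrev')
    (stFinSampler_isRowStochastic hμ hM ht0 ht1) (stFinSampler_detailedBalance hμ hMrev) hα
    (stFinLaw_le_of_le hb)
  -- `Gap(μ) ≤ b·(1/a)·Gap(μ')`
  rw [div_mul_eq_mul_div, div_le_iff₀ hb0]
  calc a * spectralGap (stFinLaw μ) (stFinSampler t μ M)
      ≤ a * (b * (1 / a) * spectralGap (stFinLaw μ') (stFinSampler t μ' M)) := mul_le_mul_of_nonneg_left h ha0.le
    _ = spectralGap (stFinLaw μ') (stFinSampler t μ' M) * b := by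
        field_simp

end Comparable

/-! ## §3 Level weights: the sampler that is actually run -/

section Weights

variable {S : Type*} [Fintype S] [DecidableEq S] {K : ℕ} {μ : Fin (K + 1) → S → ℝ}
  {M : Fin (K + 1) → Matrix S S ℝ} {t : ℝ} {w : Fin (K + 1) → ℝ} {lo hi : ℝ}

omit [DecidableEq S] in
/-- With level weights `w` (`Σ_k w_k = 1`) the target of `μʷ_k = (K+1)w_kμ_k` is a probability law. [ours] -/
theorem sum_stFinLaw_weights (hμ1 : ∀ k, ∑ x, μ k x = 1) (hw1 : ∑ k, w k = 1) :
    ∑ p, stFinLaw (fun k x => (K + 1) * w k * μ k x) p = 1 := by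
  unfold stFinLaw
  rw [Fintype.sum_prod_type]
  have h : ∀ k : Fin (K + 1), ∑ x, (K + 1 : ℝ) * w k * μ k x / (K + 1) = w k := by
    intro k
    rw [← Finset.sum_div, ← Finset.mul_sum, hμ1 k, mul_one, mul_comm, mul_div_assoc, div_self (by positivity),
      mul_one]
  simp_rw [h, hw1]

omit [DecidableEq S] in
/-- **The misweighted sampler spends the fraction `w_k` of its time at level `k`:** the level marginal of the
target of `μʷ` is `w`. [ours] -/
theorem stFin_blockMass_weights (hμ1 : ∀ k, ∑ x, μ k x = 1) (k : Fin (K + 1)) :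
    blockMass (stFinLaw (fun k x => (K + 1) * w k * μ k x)) Prod.fst k = w k := by
  unfold blockMass
  rw [sum_block_fst]
  unfold stFinLaw
  dsimp only
  rw [← Finset.sum_div, ← Finset.mul_sum, hμ1 k, mul_one, mul_comm, mul_div_assoc, div_self (by positivity), mul_one]

omit [Fintype S] [DecidableEq S] in
/-- The weighted levels are positive. [ours] -/
theorem stFinWeights_pos (hμ : ∀ k x, 0 < μ k x) (hw : ∀ k, 0 < w k) (k : Fin (K + 1)) (x : S) :
    0 < (K + 1 : ℝ) * w k * μ k x := mul_pos (mul_pos (by positivity) (hw k)) (hμ k x)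

omit [Fintype S] [DecidableEq S] in
/-- `M_k` reversible for `μ_k` is reversible for `μʷ_k`. [ours] -/
theorem stFinWeights_detailedBalance (hMrev : ∀ k, DetailedBalance (μ k) (M k)) (k : Fin (K + 1)) :
    DetailedBalance ((fun k x => (K + 1 : ℝ) * w k * μ k x) k) (M k) :=
  detailedBalance_smul (hMrev k) _

/-- **IMPERFECT WEIGHTS COST AT MOST THE FACTOR `lo/hi`:** `lo ≤ (K+1)w_k ≤ hi` for every level (`lo > 0`,
`Σ w = 1`) ⇒ `(lo/hi)·Gap(stFinSampler t μ M) ≤ Gap(stFinSampler t μʷ M)`. [ours] -/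
theorem stFinWeights_spectralGap_ge (hK : 1 ≤ K) (hμ : ∀ k x, 0 < μ k x) (hμ1 : ∀ k, ∑ x, μ k x = 1)
    (hw : ∀ k, 0 < w k) (hw1 : ∑ k, w k = 1) (hlo0 : 0 < lo) (hlo : ∀ k, lo ≤ (K + 1) * w k)
    (hhi : ∀ k, (K + 1) * w k ≤ hi) (hM : ∀ k, IsRowStochastic (M k)) (hMrev : ∀ k, DetailedBalance (μ k) (M k))
    (ht0 : 0 ≤ t) (ht1 : t ≤ 1) :
    lo / hi * spectralGap (stFinLaw μ) (stFinSampler t μ M)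
      ≤ spectralGap (stFinLaw (fun k x => (K + 1) * w k * μ k x))
          (stFinSampler t (fun k x => (K + 1) * w k * μ k x) M) := by
  haveI : Nonempty S := by
    by_contra h
    rw [not_nonempty_iff] at h
    have := hμ1 0
    rw [Finset.univ_eq_empty, Finset.sum_empty] at this
    exact zero_ne_one this
  exact stFin_spectralGap_ge_of_comparable hK hμ (stFinWeights_pos hμ hw) (sum_stFinLaw hμ1)
    (sum_stFinLaw_weights hμ1 hw1) hlo0 (fun k x => mul_le_mul_of_nonneg_right (hlo k) (hμ k x).le)
    (fun k x => mul_le_mul_of_nonneg_right (hhi k) (hμ k x).le) hM hMrev (stFinWeights_detailedBalance hMrev)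
    ht0 ht1

/-- **… AND GAIN AT MOST THE FACTOR `hi/lo`:** `Gap(stFinSampler t μʷ M) ≤ (hi/lo)·Gap(stFinSampler t μ M)` — a
torpid exactly weighted sampler stays torpid with any bounded reweighting of the levels. [ours] -/
theorem stFinWeights_spectralGap_le (hK : 1 ≤ K) (hμ : ∀ k x, 0 < μ k x) (hμ1 : ∀ k, ∑ x, μ k x = 1)
    (hw : ∀ k, 0 < w k) (hw1 : ∑ k, w k = 1) (hlo0 : 0 < lo) (hlo : ∀ k, lo ≤ (K + 1) * w k)
    (hhi : ∀ k, (K + 1) * w k ≤ hi) (hM : ∀ k, IsRowStochastic (M k)) (hMrev : ∀ k, DetailedBalance (μ k) (M k))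
    (ht0 : 0 ≤ t) (ht1 : t ≤ 1) :
    spectralGap (stFinLaw (fun k x => (K + 1) * w k * μ k x)) (stFinSampler t (fun k x => (K + 1) * w k * μ k x) M)
      ≤ hi / lo * spectralGap (stFinLaw μ) (stFinSampler t μ M) := by
  haveI : Nonempty S := by
    by_contra h
    rw [not_nonempty_iff] at h
    have := hμ1 0
    rw [Finset.univ_eq_empty, Finset.sum_empty] at this
    exact zero_ne_one this
  have hhi0 : 0 < hi := lt_of_lt_of_le (lt_of_lt_of_le hlo0 (hlo 0)) (hhi 0)
  -- the exact family is comparable to the weighted one with constants `1/hi`, `1/lo`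
  have ha : ∀ k x, 1 / hi * ((K + 1 : ℝ) * w k * μ k x) ≤ μ k x := by
    intro k x
    rw [one_div, inv_mul_le_iff₀ hhi0]
    exact mul_le_mul_of_nonneg_right (hhi k) (hμ k x).le
  have hb : ∀ k x, μ k x ≤ 1 / lo * ((K + 1 : ℝ) * w k * μ k x) := by
    intro k x
    rw [one_div, le_inv_mul_iff₀ hlo0]
    exact mul_le_mul_of_nonneg_right (hlo k) (hμ k x).le
  have h := stFin_spectralGap_ge_of_comparable hK (stFinWeights_pos hμ hw) hμ (sum_stFinLaw_weights hμ1 hw1)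
    (sum_stFinLaw hμ1) (by positivity) ha hb hM (stFinWeights_detailedBalance hMrev) hMrev ht0 ht1
  have hne : hi ≠ 0 := hhi0.ne'
  have hne' : lo ≠ 0 := hlo0.ne'
  have e : (1 : ℝ) / hi / (1 / lo) = lo / hi := by
    field_simp
  rw [e, div_mul_eq_mul_div, div_le_iff₀ hhi0] at h
  rw [div_mul_eq_mul_div, le_div_iff₀ hlo0]
  linarith

/-- **EVERY GAP GUARANTEE FOR EXACT WEIGHTS IS A `τ_int` GUARANTEE FOR THE SAMPLER ACTUALLY RUN:** a Poincaré
constant `γ ≤ Gap(stFinSampler t μ M)` (`γ > 0`) and `lo ≤ (K+1)w_k ≤ hi` give, for every non-constant observable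
`g` of the misweighted sampler (`0 < t < 1`, irreducible `M_k`), `asympVar(g)/(2Var(g)) ≤ hi/(lo·γ) − ½`. [ours] -/
theorem stFinWeights_tauInt_le (hK : 1 ≤ K) (hμ : ∀ k x, 0 < μ k x) (hμ1 : ∀ k, ∑ x, μ k x = 1)
    (hw : ∀ k, 0 < w k) (hw1 : ∑ k, w k = 1) (hlo0 : 0 < lo) (hlo : ∀ k, lo ≤ (K + 1) * w k)
    (hhi : ∀ k, (K + 1) * w k ≤ hi) (hM : ∀ k, IsRowStochastic (M k)) (hMrev : ∀ k, DetailedBalance (μ k) (M k))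
    (hMirr : ∀ k, IsIrreducible (M k)) (ht0 : 0 < t) (ht1 : t < 1) {γ : ℝ} (hγ0 : 0 < γ)
    (hγ : γ ≤ spectralGap (stFinLaw μ) (stFinSampler t μ M))
    {g : Fin (K + 1) × S → ℝ} (hg : 0 < lawVariance (stFinLaw (fun k x => (K + 1) * w k * μ k x)) g) :
    asympVar g (stFinLaw (fun k x => (K + 1) * w k * μ k x)) (stFinSampler t (fun k x => (K + 1) * w k * μ k x) M)
        / (2 * lawVariance (stFinLaw (fun k x => (K + 1) * w k * μ k x)) g)
      ≤ hi / (lo * γ) - 1 / 2 := by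
  haveI : Nonempty S := by
    by_contra h
    rw [not_nonempty_iff] at h
    have := hμ1 0
    rw [Finset.univ_eq_empty, Finset.sum_empty] at this
    exact zero_ne_one this
  haveI : Nontrivial (Fin (K + 1)) := Fin.nontrivial_iff_two_le.mpr (by omega)
  set μw : Fin (K + 1) → S → ℝ := fun k x => (K + 1) * w k * μ k x with hμw
  have hμw0 : ∀ k x, 0 < μw k x := stFinWeights_pos hμ hw
  have hhi0 : 0 < hi := lt_of_lt_of_le (lt_of_lt_of_le hlo0 (hlo 0)) (hhi 0)
  have hP := stFinSampler_isRowStochastic (M := M) hμw0 hM ht0.le ht1.le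
  have hDB := stFinSampler_detailedBalance (t := t) (M := M) hμw0 (stFinWeights_detailedBalance hMrev)
  have hirr := stFinSampler_isIrreducible hμw0 hM hMirr ht0 ht1
  have h1 := asympVar_le_spectralGap (stFinLaw_pos hμw0) (sum_stFinLaw_weights hμ1 hw1) hP hDB hirr g
  have hG := stFinWeights_spectralGap_ge (M := M) hK hμ hμ1 hw hw1 hlo0 hlo hhi hM hMrev ht0.le ht1.le
  -- `Gap(μʷ) ≥ (lo/hi)γ > 0`
  have hGw : lo / hi * γ ≤ spectralGap (stFinLaw μw) (stFinSampler t μw M) :=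
    (mul_le_mul_of_nonneg_left hγ (div_pos hlo0 hhi0).le).trans hG
  have hc : 0 < lo / hi * γ := by positivity
  have hVar := lawVariance_nonneg (fun q => (stFinLaw_pos hμw0 q).le) g
  have h2 : asympVar g (stFinLaw μw) (stFinSampler t μw M) ≤ (2 / (lo / hi * γ) - 1) * lawVariance (stFinLaw μw) g := by
    refine h1.trans (mul_le_mul_of_nonneg_right ?_ hVar)
    have := div_le_div_of_nonneg_left (by norm_num : (0 : ℝ) ≤ 2) hc hGw
    linarith
  rw [div_le_iff₀ (by positivity)]
  have e : (hi / (lo * γ) - 1 / 2) * (2 * lawVariance (stFinLaw μw) g)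
      = (2 / (lo / hi * γ) - 1) * lawVariance (stFinLaw μw) g := by
    field_simp
  rw [e]
  exact h2

end Weights

/-! ## §4 Contrast: replica exchange needs no weights at all -/

section ReplicaExchange

variable {S : Type*} [Fintype S] [DecidableEq S] {K : ℕ} {μ : Fin (K + 1) → S → ℝ} {c : Fin (K + 1) → ℝ}

omit [Fintype S] [DecidableEq S] in
/-- Rescaling every level law rescales the product target by the constant `Π_k c_k`. [ours] -/
theorem ptFinLaw_smul (p : Fin (K + 1) × (Fin (K + 1) → S)) :
    ptFinLaw (fun k x => c k * μ k x) p = (∏ k, c k) * ptFinLaw μ p := by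
  unfold ptFinLaw
  rw [← tensorFun_mul, mul_div_assoc]
  rfl

/-- **THE REPLICA-EXCHANGE SAMPLER IS INVARIANT UNDER LEVEL-WISE RESCALING OF THE WEIGHTS** (`c_k ≠ 0`): the swap
acceptance `min{1, μ_k(y)μ_l(x)/(μ_k(x)μ_l(y))}` only sees ratios within a level, so `ptFinSampler t μᶜ M =
ptFinSampler t μ M` for `μᶜ_k = c_kμ_k` — no normalising constant is ever needed, in contrast with §3. [ours] -/
theorem ptFinSampler_smul (hc : ∀ k, c k ≠ 0) (t : ℝ) (M : Fin (K + 1) → S → S → ℝ) :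
    ptFinSampler t (fun k x => c k * μ k x) M = ptFinSampler t μ M := by
  have hC : (∏ k, c k) ≠ 0 := Finset.prod_ne_zero_iff.mpr fun k _ => hc k
  have hlaw : ptFinLaw (fun k x => c k * μ k x) = fun p => (∏ k, c k) * ptFinLaw μ p :=
    funext fun p => ptFinLaw_smul p
  have hswap : ptFinSwap (fun k x => c k * μ k x) = ptFinSwap (S := S) μ := by
    unfold ptFinSwap
    rw [hlaw, mhKernel_smul hC]
  ext p q
  rw [ptFinSampler_apply, ptFinSampler_apply, hswap]

end ReplicaExchange

end Summit.Ventures.LatticeQCDFlow.Scaling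

end
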